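import Literature.NumberTheory.LFunctions.RiemannSiegelIntegralFormula
import Literature.Analysis.SpecialFunctions.GammaStirlingOrder
import HarnessLib

/-!
# The factor `χ(s)` of the Riemann–Siegel formula off the real axis: analyticity and size

Topic `Literature/NumberTheory/LFunctions` (namespace
`Literature.NumberTheory.LFunctions.SiegelIntegral`). Everything here is PROVED; there are no
definitions and no named facts.

`RiemannSiegelIntegralFormula.lean` introduces `χ(s) = rsChi s = (2π)^s/(2Γ(s)cos(πs/2))`
(Titchmarsh (2.1.8)–(2.1.9)) and proves its differentiability on `{0 < σ < 3} ∖ {1}` only, which is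
all the strip `0 < σ < 3` of the integral formula needs. Levinson's method applies the argument
principle to Conrey's function `V = 𝜙(−δ/L)𝓡 + χ · 𝜙(1−δ/L)K` on rectangles `[½, σ₀] × [T₁, T₂]`
and Jensen/Backlund discs around their corners, which leave that strip; what is used there is
that `χ` is analytic at every point off the real axis and of size `≍ (t/2π)^{1/2−σ}`
(Titchmarsh (4.12.3)). We prove:

* `cos_pi_mul_div_two_ne_zero_of_im_ne_zero`, `differentiableAt_rsChi_of_im_ne_zero`,
  `analyticAt_rsChi_of_im_ne_zero` — `χ` is analytic on `{Im s ≠ 0}`;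
* `norm_Gamma_add_nat_ge`, `norm_Gamma_ge_of_half_le_re`, `norm_Gamma_ge_of_re_nonneg` — crude
  lower bounds `‖Γ(x+iy)‖ ≥ (2/15)e^{−π|y|/2}` (`x ≥ ½`, `|y| ≥ 1`) and
  `≥ (2/15)e^{−π|y|/2}/(|y|+½)` (`x ≥ 0`), from the tree's bound on `½ ≤ x ≤ 5/2`
  (`Literature.Analysis.SpecialFunctions.norm_Gamma_ge_exp`) and the recurrence `Γ(z+1) = zΓ(z)`;
* `norm_rsChi_eq`, `norm_rsChi_le_of_re_nonneg` — `‖χ(x+iy)‖ ≤ 15 (2π)^x (y + ½)` for `x ≥ 0`,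
  `y ≥ 1` (crude, polynomial in `y`: enough inside `log`'s);
* `norm_rsChi_five_halves_le` — on `σ = 5/2` the true order: `‖χ(5/2 + it)‖ ≤ 6π²/t²` for
  `t ≥ 1` (`|Γ(½+it)|² = π/cosh πt` and the recurrence give `|Γ(5/2+it)|² ≥ t⁴ π/cosh πt`, and
  `|cos(π(5/2+it)/2)| ≥ sinh(πt/2)`).

## References

* E. C. Titchmarsh, *The Theory of the Riemann Zeta-Function*, 2nd ed. (1986), §2.1
  (2.1.8)–(2.1.9), §4.12 (4.12.3). [Titchmarsh1986]
* J. B. Conrey, J. Number Theory 16 (1983), 49–74, §4 (2)–(3). [Conrey1983]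
-/

noncomputable section

open Complex Set Real

namespace Literature.NumberTheory.LFunctions

namespace SiegelIntegral

open Literature.Analysis.SpecialFunctions

/-! ### Analyticity of `χ` off the real axis -/

/-- `cos(πs/2) ≠ 0` when `Im s ≠ 0` (`‖cos w‖ ≥ |sinh(Im w)|`). [folklore] -/
theorem cos_pi_mul_div_two_ne_zero_of_im_ne_zero {s : ℂ} (hs : s.im ≠ 0) :
    Complex.cos (π * s / 2) ≠ 0 := by
  intro h
  have h1 := abs_sinh_im_le_norm_cos (π * s / 2)
  rw [h, norm_zero] at h1
  have him : (π * s / 2 : ℂ).im = π * s.im / 2 := by simp [mul_im, div_ofNat_im]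
  rw [him] at h1
  have h0 : Real.sinh (π * s.im / 2) = 0 := abs_eq_zero.1 (le_antisymm h1 (abs_nonneg _))
  rw [Real.sinh_eq_zero] at h0
  rcases mul_eq_zero.1 (show π * s.im = 0 by linarith) with h2 | h2
  · exact Real.pi_ne_zero h2
  · exact hs h2

/-- **`χ` is differentiable at every `s` with `Im s ≠ 0`** (`Γ` has no poles or zeros there and
`cos(πs/2) ≠ 0`). [cite: Titchmarsh1986, §2.1 eqs. (2.1.8)–(2.1.9)] -/
theorem differentiableAt_rsChi_of_im_ne_zero {s : ℂ} (hs : s.im ≠ 0) :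
    DifferentiableAt ℂ rsChi s := by
  have hpole : ∀ m : ℕ, s ≠ -m := fun m h ↦ hs (by rw [h]; simp)
  have hG : DifferentiableAt ℂ Complex.Gamma s := Complex.differentiableAt_Gamma s hpole
  have h1 : DifferentiableAt ℂ (fun z : ℂ ↦ (2 * π : ℂ) ^ z) s :=
    differentiableAt_id.const_cpow (Or.inl (by simp [Real.pi_ne_zero]))
  have h2 : DifferentiableAt ℂ (fun z : ℂ ↦ 2 * Complex.Gamma z * Complex.cos (π * z / 2)) s :=
    (hG.const_mul _).mul (by fun_prop)
  have h3 : (2 * Complex.Gamma s * Complex.cos (π * s / 2)) ≠ 0 :=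
    mul_ne_zero (mul_ne_zero two_ne_zero (Complex.Gamma_ne_zero hpole))
      (cos_pi_mul_div_two_ne_zero_of_im_ne_zero hs)
  exact h1.div h2 h3

/-- The set `{Im s ≠ 0}` is open. [folklore] -/
theorem isOpen_setOf_im_ne_zero : IsOpen {s : ℂ | s.im ≠ 0} :=
  isOpen_ne_fun Complex.continuous_im continuous_const

/-- **`χ` is analytic at every `s` with `Im s ≠ 0`.** [cite: Titchmarsh1986, §2.1 eqs. (2.1.8)–(2.1.9)] -/
theorem analyticAt_rsChi_of_im_ne_zero {s : ℂ} (hs : s.im ≠ 0) : AnalyticAt ℂ rsChi s := by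
  have hd : DifferentiableOn ℂ rsChi {s : ℂ | s.im ≠ 0} := fun z hz ↦
    (differentiableAt_rsChi_of_im_ne_zero hz).differentiableWithinAt
  exact hd.analyticOnNhd isOpen_setOf_im_ne_zero s hs

/-! ### Crude lower bounds for `‖Γ(x + iy)‖`, `x ≥ 0`, `|y| ≥ 1` -/

/-- For `½ ≤ x ≤ 3/2`, `|y| ≥ 1` and every `n : ℕ`, `‖Γ(x + n + iy)‖ ≥ (2/15) e^{−π|y|/2}`
(induction on `n`: `Γ(z+1) = zΓ(z)` and `|z| ≥ |Im z| ≥ 1`). [folklore] -/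
theorem norm_Gamma_add_nat_ge {x y : ℝ} (h1 : 1 / 2 ≤ x) (h2 : x ≤ 3 / 2) (hy : 1 ≤ |y|) (n : ℕ) :
    2 / 15 * Real.exp (-(π * |y|) / 2) ≤ ‖Complex.Gamma (x + n + y * I)‖ := by
  induction n with
  | zero => simpa using norm_Gamma_ge_exp h1 (by linarith) y
  | succ n ih =>
    have hy0 : y ≠ 0 := fun h ↦ by rw [h, abs_zero] at hy; linarith
    have hz : ((x : ℂ) + n + y * I) ≠ 0 := by
      intro h
      have := congrArg Complex.im h
      simp at this
      exact hy0 this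
    have hrec : Complex.Gamma (x + ((n + 1 : ℕ) : ℂ) + y * I) =
        ((x : ℂ) + n + y * I) * Complex.Gamma (x + n + y * I) := by
      rw [show ((x : ℂ) + ((n + 1 : ℕ) : ℂ) + y * I) = ((x : ℂ) + n + y * I) + 1 by push_cast; ring]
      exact Complex.Gamma_add_one _ hz
    rw [hrec, norm_mul]
    have h1le : 1 ≤ ‖((x : ℂ) + n + y * I)‖ := by
      calc (1 : ℝ) ≤ |y| := hy
        _ = |((x : ℂ) + n + y * I).im| := by simp
        _ ≤ ‖((x : ℂ) + n + y * I)‖ := Complex.abs_im_le_norm _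
    calc 2 / 15 * Real.exp (-(π * |y|) / 2) ≤ ‖Complex.Gamma (x + n + y * I)‖ := ih
      _ = 1 * ‖Complex.Gamma (x + n + y * I)‖ := (one_mul _).symm
      _ ≤ ‖((x : ℂ) + n + y * I)‖ * ‖Complex.Gamma (x + n + y * I)‖ :=
          mul_le_mul_of_nonneg_right h1le (norm_nonneg _)

/-- **`‖Γ(x + iy)‖ ≥ (2/15) e^{−π|y|/2}` for all `x ≥ ½`, `|y| ≥ 1`.** [folklore] -/
theorem norm_Gamma_ge_of_half_le_re {x y : ℝ} (hx : 1 / 2 ≤ x) (hy : 1 ≤ |y|) :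
    2 / 15 * Real.exp (-(π * |y|) / 2) ≤ ‖Complex.Gamma (x + y * I)‖ := by
  set n : ℕ := ⌊x - 1 / 2⌋₊ with hn
  have hn1 : (n : ℝ) ≤ x - 1 / 2 := Nat.floor_le (by linarith)
  have hn2 : x - 1 / 2 < n + 1 := Nat.lt_floor_add_one _
  have h := norm_Gamma_add_nat_ge (x := x - n) (y := y) (by linarith) (by linarith) hy n
  have e : (((x - n : ℝ)) : ℂ) + n + y * I = x + y * I := by push_cast; ring
  rwa [e] at h

/-- **`‖Γ(x + iy)‖ ≥ (2/15) e^{−π|y|/2}/(|y| + ½)` for all `x ≥ 0`, `|y| ≥ 1`** (for `x < ½` use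
`Γ(z) = Γ(z+1)/z`, `|z| ≤ |y| + ½`). [folklore] -/
theorem norm_Gamma_ge_of_re_nonneg {x y : ℝ} (hx : 0 ≤ x) (hy : 1 ≤ |y|) :
    2 / 15 * Real.exp (-(π * |y|) / 2) / (|y| + 1 / 2) ≤ ‖Complex.Gamma (x + y * I)‖ := by
  have hE := Real.exp_pos (-(π * |y|) / 2)
  rcases le_or_gt (1 / 2 : ℝ) x with h | h
  · calc 2 / 15 * Real.exp (-(π * |y|) / 2) / (|y| + 1 / 2) ≤ 2 / 15 * Real.exp (-(π * |y|) / 2) :=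
          div_le_self (by positivity) (by linarith [abs_nonneg y])
      _ ≤ ‖Complex.Gamma (x + y * I)‖ := norm_Gamma_ge_of_half_le_re h hy
  · have hy0 : y ≠ 0 := fun h ↦ by rw [h, abs_zero] at hy; linarith
    have hz : ((x : ℂ) + y * I) ≠ 0 := by
      intro h0
      have := congrArg Complex.im h0
      simp at this
      exact hy0 this
    have hrec := Complex.Gamma_add_one _ hz
    have hG1 := norm_Gamma_ge_of_half_le_re (x := x + 1) (y := y) (by linarith) hy
    have e : (((x + 1 : ℝ)) : ℂ) + y * I = ((x : ℂ) + y * I) + 1 := by push_cast; ring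
    rw [e, hrec, norm_mul] at hG1
    have hz1 : ‖((x : ℂ) + y * I)‖ ≤ |y| + 1 / 2 := by
      calc ‖((x : ℂ) + y * I)‖ ≤ ‖(x : ℂ)‖ + ‖(y : ℂ) * I‖ := norm_add_le _ _
        _ = |x| + |y| := by simp
        _ ≤ |y| + 1 / 2 := by rw [abs_of_nonneg hx]; linarith
    have hzpos : 0 < ‖((x : ℂ) + y * I)‖ := norm_pos_iff.2 hz
    rw [div_le_iff₀ (by linarith [abs_nonneg y])]
    calc 2 / 15 * Real.exp (-(π * |y|) / 2) ≤ ‖((x : ℂ) + y * I)‖ * ‖Complex.Gamma (x + y * I)‖ := hG1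
      _ ≤ (|y| + 1 / 2) * ‖Complex.Gamma (x + y * I)‖ := mul_le_mul_of_nonneg_right hz1 (norm_nonneg _)
      _ = ‖Complex.Gamma (x + y * I)‖ * (|y| + 1 / 2) := mul_comm _ _

/-! ### The size of `χ` -/

/-- `‖(2π)^s‖ = (2π)^{Re s}`. [folklore] -/
theorem norm_two_pi_cpow (s : ℂ) : ‖(2 * π : ℂ) ^ s‖ = (2 * π) ^ s.re := by
  rw [show (2 * (π : ℂ)) = ((2 * π : ℝ) : ℂ) by push_cast; ring,
    Complex.norm_cpow_eq_rpow_re_of_pos (by positivity)]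

/-- `‖χ(s)‖ = (2π)^{σ}/(2‖Γ(s)‖ ‖cos(πs/2)‖)`. [cite: Titchmarsh1986, §4.12 eq. (4.12.3)] -/
theorem norm_rsChi_eq (s : ℂ) :
    ‖rsChi s‖ = (2 * π) ^ s.re / (2 * ‖Complex.Gamma s‖ * ‖Complex.cos (π * s / 2)‖) := by
  rw [rsChi, norm_div, norm_mul, norm_mul, Complex.norm_two, norm_two_pi_cpow]

/-- `sinh(πy/2) ≤ ‖cos(π(x+iy)/2)‖`. [folklore] -/
theorem sinh_le_norm_cos_pi_mul_div_two (x y : ℝ) :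
    Real.sinh (π * y / 2) ≤ ‖Complex.cos (π * (x + y * I) / 2)‖ := by
  have h := abs_sinh_im_le_norm_cos (π * (x + y * I) / 2)
  have him : (π * (x + y * I) / 2 : ℂ).im = π * y / 2 := by
    simp [mul_im, div_ofNat_im]
  rw [him] at h
  exact (le_abs_self _).trans h

/-- **Crude bound `‖χ(x + iy)‖ ≤ 15 (2π)^x (y + ½)` for `x ≥ 0`, `y ≥ 1`** (from
`‖Γ(x+iy)‖ ≥ (2/15)e^{−πy/2}/(y+½)`, `‖cos(π(x+iy)/2)‖ ≥ sinh(πy/2) ≥ e^{πy/2}/4`).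
[cite: Titchmarsh1986, §4.12 eq. (4.12.3)] -/
theorem norm_rsChi_le_of_re_nonneg {x y : ℝ} (hx : 0 ≤ x) (hy : 1 ≤ y) :
    ‖rsChi (x + y * I)‖ ≤ 15 * (2 * π) ^ x * (y + 1 / 2) := by
  have hπ := Real.pi_gt_three
  rw [norm_rsChi_eq]
  have hre : ((x : ℂ) + y * I).re = x := by simp
  rw [hre]
  have hyabs : |y| = y := abs_of_pos (by linarith)
  have hG := norm_Gamma_ge_of_re_nonneg hx (y := y) (by rw [hyabs]; exact hy)
  rw [hyabs] at hG
  have hcos := sinh_le_norm_cos_pi_mul_div_two x y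
  have hsinh : Real.exp (π * y / 2) ≤ 4 * Real.sinh (π * y / 2) :=
    exp_le_four_mul_sinh (by nlinarith)
  have hsinh0 : 0 ≤ Real.sinh (π * y / 2) := Real.sinh_nonneg_iff.2 (by positivity)
  have hee : Real.exp (-(π * y) / 2) * Real.exp (π * y / 2) = 1 := by
    rw [← Real.exp_add]; convert Real.exp_zero using 2; ring
  have hden : 1 / 15 / (y + 1 / 2) ≤ 2 * ‖Complex.Gamma (x + y * I)‖ * ‖Complex.cos (π * (x + y * I) / 2)‖ := by
    have e1 : 2 * (2 / 15 * Real.exp (-(π * y) / 2) / (y + 1 / 2)) * (Real.exp (π * y / 2) / 4) =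
        1 / 15 / (y + 1 / 2) * (Real.exp (-(π * y) / 2) * Real.exp (π * y / 2)) := by ring
    rw [hee, mul_one] at e1
    calc 1 / 15 / (y + 1 / 2)
        = 2 * (2 / 15 * Real.exp (-(π * y) / 2) / (y + 1 / 2)) * (Real.exp (π * y / 2) / 4) := e1.symm
      _ ≤ 2 * ‖Complex.Gamma (x + y * I)‖ * Real.sinh (π * y / 2) := by
          gcongr
          linarith
      _ ≤ 2 * ‖Complex.Gamma (x + y * I)‖ * ‖Complex.cos (π * (x + y * I) / 2)‖ := by gcongr
  have hpos : 0 < 1 / 15 / (y + 1 / 2) := by positivity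
  calc (2 * π) ^ x / (2 * ‖Complex.Gamma (x + y * I)‖ * ‖Complex.cos (π * (x + y * I) / 2)‖)
      ≤ (2 * π) ^ x / (1 / 15 / (y + 1 / 2)) := div_le_div_of_nonneg_left (by positivity) hpos hden
    _ = 15 * (2 * π) ^ x * (y + 1 / 2) := by field_simp

/-- **`‖χ(5/2 + it)‖ ≤ 6π²/t²` for `t ≥ 1`** — the true order `(t/2π)^{1/2−σ}` on `σ = 5/2`:
`|Γ(5/2+it)|² = |3/2+it|²|1/2+it|² π/cosh πt ≥ t⁴π/cosh πt`, `|cos(π(5/2+it)/2)| ≥ sinh(πt/2)` and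
`cosh πt = 2sinh²(πt/2) + 1 ≤ 4 sinh²(πt/2)`, so `‖χ‖² ≤ (2π)⁵/(πt⁴) = 32π⁴/t⁴`.
[cite: Titchmarsh1986, §4.12 eq. (4.12.3)] -/
theorem norm_rsChi_five_halves_le {t : ℝ} (ht : 1 ≤ t) :
    ‖rsChi (5 / 2 + t * I)‖ ≤ 6 * π ^ 2 / t ^ 2 := by
  have hπ := Real.pi_gt_three
  have hπ0 := Real.pi_pos
  have ht0 : 0 < t := by linarith
  rw [norm_rsChi_eq]
  have hre : ((5 / 2 : ℂ) + t * I).re = 5 / 2 := by simp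
  rw [hre]
  -- the Gamma factor
  set z₀ : ℂ := 1 / 2 + t * I with hz₀
  set z₁ : ℂ := 3 / 2 + t * I with hz₁
  have ht0' : t ≠ 0 := ht0.ne'
  have hz₀0 : z₀ ≠ 0 := fun h ↦ ht0' (by have := congrArg Complex.im h; simpa [hz₀] using this)
  have hz₁0 : z₁ ≠ 0 := fun h ↦ ht0' (by have := congrArg Complex.im h; simpa [hz₁] using this)
  have hΓ : Complex.Gamma (5 / 2 + t * I) = z₁ * (z₀ * Complex.Gamma z₀) := by
    rw [← Complex.Gamma_add_one _ hz₀0, show z₀ + 1 = z₁ by rw [hz₀, hz₁]; ring,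
      ← Complex.Gamma_add_one _ hz₁0, hz₁]
    ring_nf
  have hΓ0sq : ‖Complex.Gamma z₀‖ ^ 2 = π / Real.cosh (π * t) := GammaVert.norm_sq_Gamma_half t
  have hz₀sq : ‖z₀‖ ^ 2 = (1 / 2) ^ 2 + t ^ 2 := by
    rw [hz₀, show (1 / 2 : ℂ) = ((1 / 2 : ℝ) : ℂ) by push_cast; ring, Complex.sq_norm,
      Complex.normSq_add_mul_I]
  have hz₁sq : ‖z₁‖ ^ 2 = (3 / 2) ^ 2 + t ^ 2 := by
    rw [hz₁, show (3 / 2 : ℂ) = ((3 / 2 : ℝ) : ℂ) by push_cast; ring, Complex.sq_norm,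
      Complex.normSq_add_mul_I]
  have hΓsq : ‖Complex.Gamma (5 / 2 + t * I)‖ ^ 2 =
      ((3 / 2) ^ 2 + t ^ 2) * (((1 / 2) ^ 2 + t ^ 2) * (π / Real.cosh (π * t))) := by
    rw [hΓ, norm_mul, norm_mul, mul_pow, mul_pow, hΓ0sq, hz₀sq, hz₁sq]
  -- the cosine factor
  have hcos : Real.sinh (π * t / 2) ≤ ‖Complex.cos (π * (5 / 2 + t * I) / 2)‖ := by
    have := sinh_le_norm_cos_pi_mul_div_two (5 / 2) t
    push_cast at this
    exact this
  set u : ℝ := Real.sinh (π * t / 2) with hu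
  have hu1 : 1 ≤ u := by
    have h1 : π * t / 2 ≤ u := Real.self_le_sinh_iff.2 (by positivity)
    nlinarith
  have hcosh : Real.cosh (π * t) = 2 * u ^ 2 + 1 := by
    rw [show π * t = 2 * (π * t / 2) by ring, Real.cosh_two_mul, Real.cosh_sq]; ring
  have hcosh0 : 0 < Real.cosh (π * t) := Real.cosh_pos _
  -- `(2‖Γ‖‖cos‖)² ≥ π t⁴`
  set D : ℝ := 2 * ‖Complex.Gamma (5 / 2 + t * I)‖ * ‖Complex.cos (π * (5 / 2 + t * I) / 2)‖ with hD
  have hD0 : 0 ≤ D := by positivity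
  have hDsq : π * t ^ 4 ≤ D ^ 2 := by
    have h1 : D ^ 2 = 4 * ‖Complex.Gamma (5 / 2 + t * I)‖ ^ 2 * ‖Complex.cos (π * (5 / 2 + t * I) / 2)‖ ^ 2 := by
      rw [hD]; ring
    have h2 : u ^ 2 ≤ ‖Complex.cos (π * (5 / 2 + t * I) / 2)‖ ^ 2 :=
      pow_le_pow_left₀ (by linarith) hcos 2
    have h3 : t ^ 4 * (π / Real.cosh (π * t)) ≤ ‖Complex.Gamma (5 / 2 + t * I)‖ ^ 2 := by
      rw [hΓsq]
      have : t ^ 4 ≤ ((3 / 2) ^ 2 + t ^ 2) * ((1 / 2) ^ 2 + t ^ 2) := by nlinarith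
      have hq : 0 ≤ π / Real.cosh (π * t) := by positivity
      nlinarith
    -- `π t⁴ ≤ 4 · t⁴ (π/cosh) · u²` since `cosh ≤ 4u²`
    have h4 : π * t ^ 4 ≤ 4 * (t ^ 4 * (π / Real.cosh (π * t))) * u ^ 2 := by
      rw [hcosh]
      have h2u : (0 : ℝ) < 2 * u ^ 2 + 1 := by positivity
      rw [show 4 * (t ^ 4 * (π / (2 * u ^ 2 + 1))) * u ^ 2 = π * t ^ 4 * (4 * u ^ 2 / (2 * u ^ 2 + 1)) by ring]
      have h5 : (1 : ℝ) ≤ 4 * u ^ 2 / (2 * u ^ 2 + 1) := by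
        rw [le_div_iff₀ h2u]; nlinarith
      have h6 : 0 ≤ π * t ^ 4 := by positivity
      nlinarith
    rw [h1]
    have hq : 0 ≤ t ^ 4 * (π / Real.cosh (π * t)) := by positivity
    calc π * t ^ 4 ≤ 4 * (t ^ 4 * (π / Real.cosh (π * t))) * u ^ 2 := h4
      _ ≤ 4 * ‖Complex.Gamma (5 / 2 + t * I)‖ ^ 2 * ‖Complex.cos (π * (5 / 2 + t * I) / 2)‖ ^ 2 := by
          gcongr
  have hDpos : 0 < D := by
    have : 0 < π * t ^ 4 := by positivity
    exact lt_of_le_of_ne hD0 (fun h ↦ by rw [← h] at hDsq; linarith)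
  -- `((2π)^{5/2})² = 32 π⁵`
  have hnum : ((2 * π) ^ (5 / 2 : ℝ)) ^ 2 = 32 * π ^ 5 := by
    rw [← Real.rpow_natCast ((2 * π) ^ (5 / 2 : ℝ)) 2, ← Real.rpow_mul (by positivity)]
    rw [show ((5 / 2 : ℝ) * (2 : ℕ)) = ((5 : ℕ) : ℝ) by norm_num, Real.rpow_natCast]
    ring
  -- conclude via squares
  have hgoal0 : 0 ≤ (2 * π) ^ (5 / 2 : ℝ) / D := by positivity
  have hrhs0 : 0 ≤ 6 * π ^ 2 / t ^ 2 := by positivity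
  rw [← sq_le_sq₀ hgoal0 hrhs0, div_pow, hnum, div_pow]
  rw [div_le_div_iff₀ (by positivity) (by positivity)]
  calc 32 * π ^ 5 * (t ^ 2) ^ 2 = 32 * π ^ 4 * (π * t ^ 4) := by ring
    _ ≤ 32 * π ^ 4 * D ^ 2 := by gcongr
    _ ≤ (6 * π ^ 2) ^ 2 * D ^ 2 := by nlinarith [sq_nonneg D, sq_nonneg π]

/-! ### `χ` on the half-integer lines `σ = m + ½` (appended) -/

/-- **`‖Γ(m + ½ + it)‖² ≥ t^{2m} · π/cosh(πt)`** for every `m : ℕ` and real `t` (equality for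
`m = 0`; then `Γ(z+1) = zΓ(z)` with `‖z‖² ≥ t²`). [folklore] -/
theorem norm_sq_Gamma_nat_add_half_ge (m : ℕ) (t : ℝ) :
    t ^ (2 * m) * (π / Real.cosh (π * t)) ≤ ‖Complex.Gamma ((m : ℂ) + 1 / 2 + t * I)‖ ^ 2 := by
  induction m with
  | zero =>
    have e : ((0 : ℕ) : ℂ) + 1 / 2 + t * I = 1 / 2 + t * I := by push_cast; ring
    rw [e, GammaVert.norm_sq_Gamma_half t]
    simp
  | succ m ih =>
    have hz : ((m : ℂ) + 1 / 2 + t * I) ≠ 0 := by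
      intro h
      have := congrArg Complex.re h
      simp at this
      linarith [m.cast_nonneg (α := ℝ)]
    have hrec : Complex.Gamma (((m + 1 : ℕ) : ℂ) + 1 / 2 + t * I) =
        ((m : ℂ) + 1 / 2 + t * I) * Complex.Gamma ((m : ℂ) + 1 / 2 + t * I) := by
      rw [show (((m + 1 : ℕ) : ℂ) + 1 / 2 + t * I) = ((m : ℂ) + 1 / 2 + t * I) + 1 by push_cast; ring]
      exact Complex.Gamma_add_one _ hz
    rw [hrec, norm_mul, mul_pow]
    have hz2 : t ^ 2 ≤ ‖(m : ℂ) + 1 / 2 + t * I‖ ^ 2 := by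
      rw [show ((m : ℂ) + 1 / 2 + t * I) = ((((m : ℝ) + 1 / 2 : ℝ)) : ℂ) + t * I by push_cast; ring,
        Complex.sq_norm, Complex.normSq_add_mul_I]
      nlinarith [sq_nonneg ((m : ℝ) + 1 / 2)]
    have hq : 0 ≤ π / Real.cosh (π * t) := by
      have := Real.cosh_pos (π * t); positivity
    have htm : 0 ≤ t ^ (2 * m) := by rw [pow_mul]; positivity
    calc t ^ (2 * (m + 1)) * (π / Real.cosh (π * t)) = t ^ 2 * (t ^ (2 * m) * (π / Real.cosh (π * t))) := by
          ring
      _ ≤ ‖(m : ℂ) + 1 / 2 + t * I‖ ^ 2 * ‖Complex.Gamma ((m : ℂ) + 1 / 2 + t * I)‖ ^ 2 :=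
          mul_le_mul hz2 ih (mul_nonneg htm hq) (by positivity)

/-- **`‖χ(m + ½ + it)‖ ≤ 2 (2π)^m / t^m` for `t ≥ 1`, `m : ℕ`** — the true order
`|χ(σ+it)| ≍ (t/2π)^{1/2−σ}` on every half-integer line (`|Γ(m+½+it)|² ≥ t^{2m}π/cosh πt`,
`|cos(π(m+½+it)/2)| ≥ sinh(πt/2)`, `cosh πt ≤ 4 sinh²(πt/2)`, so
`‖χ‖² ≤ (2π)^{2m+1}/(π t^{2m}) = 2(2π)^{2m}/t^{2m}`). [cite: Titchmarsh1986, §4.12 eq. (4.12.3)] -/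
theorem norm_rsChi_nat_add_half_le (m : ℕ) {t : ℝ} (ht : 1 ≤ t) :
    ‖rsChi ((((m : ℝ) + 1 / 2 : ℝ)) + t * I)‖ ≤ 2 * (2 * π) ^ m / t ^ m := by
  have hπ := Real.pi_gt_three
  have hπ0 := Real.pi_pos
  have ht0 : 0 < t := by linarith
  rw [norm_rsChi_eq]
  have hre : (((((m : ℝ) + 1 / 2 : ℝ)) : ℂ) + t * I).re = (m : ℝ) + 1 / 2 := by simp
  rw [hre]
  have es : (((((m : ℝ) + 1 / 2 : ℝ)) : ℂ) + t * I) = (m : ℂ) + 1 / 2 + t * I := by push_cast; ring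
  -- the Gamma factor
  have hΓ := norm_sq_Gamma_nat_add_half_ge m t
  rw [← es] at hΓ
  -- the cosine factor
  have hcos : Real.sinh (π * t / 2) ≤ ‖Complex.cos (π * (((((m : ℝ) + 1 / 2 : ℝ)) : ℂ) + t * I) / 2)‖ :=
    sinh_le_norm_cos_pi_mul_div_two ((m : ℝ) + 1 / 2) t
  set u : ℝ := Real.sinh (π * t / 2) with hu
  have hu1 : 1 ≤ u := by
    have h1 : π * t / 2 ≤ u := Real.self_le_sinh_iff.2 (by positivity)
    nlinarith
  have hcosh : Real.cosh (π * t) = 2 * u ^ 2 + 1 := by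
    rw [show π * t = 2 * (π * t / 2) by ring, Real.cosh_two_mul, Real.cosh_sq]; ring
  set G : ℝ := ‖Complex.Gamma (((((m : ℝ) + 1 / 2 : ℝ)) : ℂ) + t * I)‖ with hG
  set K : ℝ := ‖Complex.cos (π * (((((m : ℝ) + 1 / 2 : ℝ)) : ℂ) + t * I) / 2)‖ with hK
  set D : ℝ := 2 * G * K with hD
  have hD0 : 0 ≤ D := by positivity
  -- `D² ≥ π t^{2m}`
  have hDsq : π * t ^ (2 * m) ≤ D ^ 2 := by
    have h1 : D ^ 2 = 4 * G ^ 2 * K ^ 2 := by rw [hD]; ring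
    have h2 : u ^ 2 ≤ K ^ 2 := pow_le_pow_left₀ (by linarith) hcos 2
    have htm : 0 ≤ t ^ (2 * m) := by positivity
    have h4 : π * t ^ (2 * m) ≤ 4 * (t ^ (2 * m) * (π / Real.cosh (π * t))) * u ^ 2 := by
      rw [hcosh]
      have h2u : (0 : ℝ) < 2 * u ^ 2 + 1 := by positivity
      rw [show 4 * (t ^ (2 * m) * (π / (2 * u ^ 2 + 1))) * u ^ 2 =
        π * t ^ (2 * m) * (4 * u ^ 2 / (2 * u ^ 2 + 1)) by ring]
      have h5 : (1 : ℝ) ≤ 4 * u ^ 2 / (2 * u ^ 2 + 1) := by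
        rw [le_div_iff₀ h2u]; nlinarith
      have h6 : 0 ≤ π * t ^ (2 * m) := by positivity
      nlinarith
    rw [h1]
    have hq : 0 ≤ t ^ (2 * m) * (π / Real.cosh (π * t)) := by
      have := Real.cosh_pos (π * t); positivity
    calc π * t ^ (2 * m) ≤ 4 * (t ^ (2 * m) * (π / Real.cosh (π * t))) * u ^ 2 := h4
      _ ≤ 4 * G ^ 2 * K ^ 2 := by gcongr
  have hDpos : 0 < D := by
    have : 0 < π * t ^ (2 * m) := by positivity
    exact lt_of_le_of_ne hD0 (fun h ↦ by rw [← h] at hDsq; linarith)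
  -- `((2π)^{m+1/2})² = (2π)^{2m+1}`
  have hnum : ((2 * π) ^ ((m : ℝ) + 1 / 2)) ^ 2 = (2 * π) ^ (2 * m + 1) := by
    rw [← Real.rpow_natCast ((2 * π) ^ ((m : ℝ) + 1 / 2)) 2, ← Real.rpow_mul (by positivity)]
    rw [show (((m : ℝ) + 1 / 2) * (2 : ℕ)) = ((2 * m + 1 : ℕ) : ℝ) by push_cast; ring, Real.rpow_natCast]
  -- conclude via squares
  have hgoal0 : 0 ≤ (2 * π) ^ ((m : ℝ) + 1 / 2) / D := by positivity
  have hrhs0 : 0 ≤ 2 * (2 * π) ^ m / t ^ m := by positivity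
  rw [← sq_le_sq₀ hgoal0 hrhs0, div_pow, hnum, div_pow]
  rw [div_le_div_iff₀ (by positivity) (by positivity)]
  have e1 : (2 * π) ^ (2 * m + 1) * (t ^ m) ^ 2 = 2 * (2 * π) ^ (2 * m) * (π * t ^ (2 * m)) := by ring
  have e2 : (2 * (2 * π) ^ m) ^ 2 = 4 * (2 * π) ^ (2 * m) := by ring
  rw [e1, e2]
  have h0 : 0 ≤ (2 * π) ^ (2 * m) := by positivity
  calc 2 * (2 * π) ^ (2 * m) * (π * t ^ (2 * m)) ≤ 2 * (2 * π) ^ (2 * m) * D ^ 2 := by gcongr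
    _ ≤ 4 * (2 * π) ^ (2 * m) * D ^ 2 := by nlinarith [sq_nonneg D]

end SiegelIntegral

end Literature.NumberTheory.LFunctions

end
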